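import Summits.HubbardSuperconductivity.HubbardSuperconductivity.Theorems.AnisotropyChordThermalChordEndpoints
import Summits.HubbardSuperconductivity.HubbardSuperconductivity.Theorems.AnisotropyChordVirialMonotone
import Literature.MathematicalPhysics.QuantumLattice.GibbsLinearResponse

/-!
# Route `AnisotropyChord`, crux `ChordXY` (stmt-HubbardSuperconductivity-8146), line `thermal_af`:
# the canonical sector condensate `Λ_{β,M}(Δ)` is DIFFERENTIABLE in the anisotropy `Δ` —
# Kubo–Duhamel linear response of the sector traces (the "analytic in Δ at fixed (β, M)" tooth of
# the line card, typed)

Notation (defs of `…Theorems.AnisotropyChordThermalCondensateDefs`): `P₀ = sectorProj M`,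
`A = condensateOp M = S⁺_tot S⁻_tot`, `H_M(Δ) = xxzHamiltonian 1 (torusGraph 2 M) (-1) Δ`,
`Λ_{β,M}(Δ) = thermalCondensate M β Δ = Re( tr(P₀ e^{-βH_M(Δ)} A) / tr(P₀ e^{-βH_M(Δ)}) )`; the XXZ
family is the affine pencil `H_M(Δ) = H_M(Δ₀) + (Δ - Δ₀)·V`, `V = H_M(1) - H_M(0)` the Ising part
(`xxzHamiltonian_affine`).

* `xxzTorus_pencil` — `H_M(Δ) = H_M(Δ₀) + (Δ - Δ₀)·V`;
* `hasDerivAt_sectorTrace_gibbsWeight_mul` — for every `X`, `Δ ↦ tr(P₀ e^{-βH_M(Δ)} X)` is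
  differentiable at every `Δ₀` with derivative the Duhamel integral
  `-β ∫₀¹ tr(X P₀ e^{-sβH} V e^{-(1-s)βH}) ds` (`H = H_M(Δ₀)`; the Literature's
  `Matrix.hasDerivAt_trace_gibbsWeight_add_smul_mul` along the pencil, cyclicity `tr(P₀WX) = tr(W·XP₀)`);
* `hasDerivAt_sectorPartition` — the same for the sector partition function `tr(P₀ e^{-βH_M(Δ)})`;
  `sectorPartition_duhamel_integrand_const`, `hasDerivAt_sectorPartition_closed` — since `P₀`
  commutes with `e^{-tβH}` the Duhamel integral collapses: `d/dΔ tr(P₀ e^{-βH_M(Δ)}) = -β tr(P₀ e^{-βH} V)`;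
* **`hasDerivAt_thermalCondensate`** — for even `M ≥ 2` (nonzero sector, `sectorPartition_pos`),
  `Δ ↦ Λ_{β,M}(Δ)` is differentiable at every `Δ₀` with the quotient-rule / linear-response value
  `Re((N'·D - N·D')/D²)`; **`differentiableAt_thermalCondensate`**, **`continuous_thermalCondensate`**.

This is the first-order half of the route's intended engine for `stub_thermalChordAF` (the thermal
chord would follow from a SIGN on the second Δ-derivative, a three-point Duhamel object not
constructed here). No crux closes. Sources: O. Bratteli, D. W. Robinson, *Operator Algebras and
Quantum Statistical Mechanics II* §5.4.1 (perturbation of KMS states, Duhamel two-point function);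
F. J. Dyson, E. H. Lieb, B. Simon, J. Stat. Phys. 18 (1978) 335, eq. (5). Folklore; no definition.
-/

set_option linter.dupNamespace false

noncomputable section

open scoped Matrix.Norms.L2Operator ComplexOrder

namespace Summit.HubbardSuperconductivity.HubbardSuperconductivity.Theorems.AnisotropyChord

open Matrix Filter Topology MeasureTheory intervalIntegral
open Literature.MathematicalPhysics.QuantumLattice Literature.Probability.LatticeModels

/-- **The XXZ torus family is an affine pencil based at any `Δ₀`**:
`H_M(Δ) = H_M(Δ₀) + (Δ - Δ₀)·(H_M(1) - H_M(0))`. [folklore] -/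
theorem xxzTorus_pencil (M : ℕ) [NeZero M] (Δ Δ₀ : ℝ) :
    xxzHamiltonian 1 (torusGraph 2 M) (-1) Δ =
      xxzHamiltonian 1 (torusGraph 2 M) (-1) Δ₀ + ((Δ - Δ₀ : ℝ) : ℂ) •
        (xxzHamiltonian 1 (torusGraph 2 M) (-1) 1 - xxzHamiltonian 1 (torusGraph 2 M) (-1) 0) := by
  have h1 := xxzHamiltonian_affine 1 (torusGraph 2 M) (-1) Δ
  have h2 := xxzHamiltonian_affine 1 (torusGraph 2 M) (-1) Δ₀
  rw [h1, h2, Complex.ofReal_sub]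
  module

/-- **Kubo–Duhamel response of a sector trace.** For every matrix `X`, the un-normalised sector
expectation `Δ ↦ tr(P₀ e^{-βH_M(Δ)} X)` is differentiable at `Δ₀`, with derivative
`-β ∫₀¹ tr(X P₀ e^{-sβH} V e^{-(1-s)βH}) ds`, `H = H_M(Δ₀)`, `V = H_M(1) - H_M(0)`.
Bratteli–Robinson II §5.4.1; Dyson–Lieb–Simon (1978) eq. (5). [folklore] -/
theorem hasDerivAt_sectorTrace_gibbsWeight_mul (M : ℕ) [NeZero M] (β Δ₀ : ℝ)
    (X : Matrix (TensorIndex (TorusSite 2 M) 2) (TensorIndex (TorusSite 2 M) 2) ℂ) :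
    HasDerivAt (fun Δ : ℝ =>
        (sectorProj M * gibbsWeight β (xxzHamiltonian 1 (torusGraph 2 M) (-1) Δ) * X).trace)
      (-(β : ℂ) * ∫ s in (0:ℝ)..1,
        (X * sectorProj M * gibbsWeight (s * β) (xxzHamiltonian 1 (torusGraph 2 M) (-1) Δ₀) *
          (xxzHamiltonian 1 (torusGraph 2 M) (-1) 1 - xxzHamiltonian 1 (torusGraph 2 M) (-1) 0) *
          gibbsWeight ((1 - s) * β) (xxzHamiltonian 1 (torusGraph 2 M) (-1) Δ₀)).trace) Δ₀ := by
  set H₀ := xxzHamiltonian 1 (torusGraph 2 M) (-1) Δ₀ with hH₀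
  set V := xxzHamiltonian 1 (torusGraph 2 M) (-1) 1 - xxzHamiltonian 1 (torusGraph 2 M) (-1) 0
    with hV
  set P := sectorProj M with hP
  -- the complex-coupling linear response along the pencil, restricted to real couplings at `0`
  have hc := Matrix.hasDerivAt_trace_gibbsWeight_add_smul_mul β H₀ V (X * P)
  rw [← Complex.ofReal_zero] at hc
  have hr : HasDerivAt (fun t : ℝ => (gibbsWeight β (H₀ + (t : ℂ) • V) * (X * P)).trace)
      (-(β : ℂ) * ∫ s in (0:ℝ)..1,
        (X * P * gibbsWeight (s * β) H₀ * V * gibbsWeight ((1 - s) * β) H₀).trace) 0 :=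
    hc.comp_ofReal
  -- translate to `Δ₀` and identify the function
  have hr' : HasDerivAt (fun t : ℝ => (gibbsWeight β (H₀ + (t : ℂ) • V) * (X * P)).trace)
      (-(β : ℂ) * ∫ s in (0:ℝ)..1,
        (X * P * gibbsWeight (s * β) H₀ * V * gibbsWeight ((1 - s) * β) H₀).trace) (Δ₀ - Δ₀) := by
    rw [sub_self]
    exact hr
  have hs := hr'.comp_sub_const Δ₀ Δ₀
  have hfun : (fun Δ : ℝ =>
      (sectorProj M * gibbsWeight β (xxzHamiltonian 1 (torusGraph 2 M) (-1) Δ) * X).trace) =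
      fun Δ : ℝ => (gibbsWeight β (H₀ + ((Δ - Δ₀ : ℝ) : ℂ) • V) * (X * P)).trace := by
    funext Δ
    rw [xxzTorus_pencil M Δ Δ₀, ← hH₀, ← hV, ← hP, Matrix.mul_assoc, trace_mul_comm, Matrix.mul_assoc]
  rw [hfun]
  exact hs

/-- **Response of the sector partition function**: `Δ ↦ tr(P₀ e^{-βH_M(Δ)})` is differentiable at
`Δ₀` with derivative `-β ∫₀¹ tr(P₀ e^{-sβH} V e^{-(1-s)βH}) ds`. [folklore] -/
theorem hasDerivAt_sectorPartition (M : ℕ) [NeZero M] (β Δ₀ : ℝ) :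
    HasDerivAt (fun Δ : ℝ =>
        (sectorProj M * gibbsWeight β (xxzHamiltonian 1 (torusGraph 2 M) (-1) Δ)).trace)
      (-(β : ℂ) * ∫ s in (0:ℝ)..1,
        (sectorProj M * gibbsWeight (s * β) (xxzHamiltonian 1 (torusGraph 2 M) (-1) Δ₀) *
          (xxzHamiltonian 1 (torusGraph 2 M) (-1) 1 - xxzHamiltonian 1 (torusGraph 2 M) (-1) 0) *
          gibbsWeight ((1 - s) * β) (xxzHamiltonian 1 (torusGraph 2 M) (-1) Δ₀)).trace) Δ₀ := by
  have h := hasDerivAt_sectorTrace_gibbsWeight_mul M β Δ₀ 1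
  simp only [Matrix.mul_one, Matrix.one_mul] at h
  exact h

/-- Along the sector the Duhamel integrand of the partition function is constant in the Duhamel
parameter: `tr(P₀ e^{-sβH} V e^{-(1-s)βH}) = tr(P₀ e^{-βH} V)` (`P₀` commutes with `e^{-tβH}`,
cyclicity, semigroup law). [folklore] -/
theorem sectorPartition_duhamel_integrand_const (M : ℕ) [NeZero M] (β Δ₀ s : ℝ) :
    (sectorProj M * gibbsWeight (s * β) (xxzHamiltonian 1 (torusGraph 2 M) (-1) Δ₀) *
        (xxzHamiltonian 1 (torusGraph 2 M) (-1) 1 - xxzHamiltonian 1 (torusGraph 2 M) (-1) 0) *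
        gibbsWeight ((1 - s) * β) (xxzHamiltonian 1 (torusGraph 2 M) (-1) Δ₀)).trace =
      (sectorProj M * gibbsWeight β (xxzHamiltonian 1 (torusGraph 2 M) (-1) Δ₀) *
        (xxzHamiltonian 1 (torusGraph 2 M) (-1) 1 - xxzHamiltonian 1 (torusGraph 2 M) (-1) 0)).trace := by
  set H₀ := xxzHamiltonian 1 (torusGraph 2 M) (-1) Δ₀ with hH₀
  set V := xxzHamiltonian 1 (torusGraph 2 M) (-1) 1 - xxzHamiltonian 1 (torusGraph 2 M) (-1) 0
    with hV
  set P := sectorProj M with hP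
  have hc : P * gibbsWeight ((1 - s) * β) H₀ = gibbsWeight ((1 - s) * β) H₀ * P :=
    (commute_gibbsWeight_of_commute (sectorProj_commute_xxz M Δ₀) _).eq
  calc (P * gibbsWeight (s * β) H₀ * V * gibbsWeight ((1 - s) * β) H₀).trace
      = (gibbsWeight ((1 - s) * β) H₀ * (P * gibbsWeight (s * β) H₀ * V)).trace := by
        rw [trace_mul_comm]
    _ = (gibbsWeight ((1 - s) * β) H₀ * P * gibbsWeight (s * β) H₀ * V).trace := by
        simp only [Matrix.mul_assoc]
    _ = (P * gibbsWeight ((1 - s) * β) H₀ * gibbsWeight (s * β) H₀ * V).trace := by rw [← hc]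
    _ = (P * (gibbsWeight ((1 - s) * β) H₀ * gibbsWeight (s * β) H₀) * V).trace := by
        rw [Matrix.mul_assoc P (gibbsWeight ((1 - s) * β) H₀) (gibbsWeight (s * β) H₀)]
    _ = (P * gibbsWeight β H₀ * V).trace := by
        rw [Matrix.gibbsWeight_mul_gibbsWeight, show (1 - s) * β + s * β = β by ring]

/-- **Response of the sector partition function, closed form**:
`d/dΔ tr(P₀ e^{-βH_M(Δ)})|_{Δ₀} = -β · tr(P₀ e^{-βH_M(Δ₀)} V)` (`V = H_M(1) - H_M(0)` the Ising part) —
the Duhamel integral collapses because `P₀` commutes with the dynamics. Dyson–Lieb–Simon (1978) §3.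
[folklore] -/
theorem hasDerivAt_sectorPartition_closed (M : ℕ) [NeZero M] (β Δ₀ : ℝ) :
    HasDerivAt (fun Δ : ℝ =>
        (sectorProj M * gibbsWeight β (xxzHamiltonian 1 (torusGraph 2 M) (-1) Δ)).trace)
      (-(β : ℂ) * (sectorProj M * gibbsWeight β (xxzHamiltonian 1 (torusGraph 2 M) (-1) Δ₀) *
        (xxzHamiltonian 1 (torusGraph 2 M) (-1) 1 - xxzHamiltonian 1 (torusGraph 2 M) (-1) 0)).trace)
      Δ₀ := by
  refine (hasDerivAt_sectorPartition M β Δ₀).congr_deriv ?_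
  rw [intervalIntegral.integral_congr (g := fun _ : ℝ =>
      (sectorProj M * gibbsWeight β (xxzHamiltonian 1 (torusGraph 2 M) (-1) Δ₀) *
        (xxzHamiltonian 1 (torusGraph 2 M) (-1) 1 - xxzHamiltonian 1 (torusGraph 2 M) (-1) 0)).trace)
      (fun s _ => sectorPartition_duhamel_integrand_const M β Δ₀ s),
    intervalIntegral.integral_const, sub_zero, one_smul]

/-- **The canonical sector condensate is differentiable in the anisotropy** (even `M ≥ 2`, every
real `β`, `Δ₀`): with `N(Δ) = tr(P₀ e^{-βH_M(Δ)} A)`, `D(Δ) = tr(P₀ e^{-βH_M(Δ)}) ≠ 0`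
(`sectorPartition_pos`) and their Kubo–Duhamel derivatives `N'`, `D'`
(`hasDerivAt_sectorTrace_gibbsWeight_mul`, `hasDerivAt_sectorPartition`),
`d/dΔ Λ_{β,M}(Δ)|_{Δ₀} = Re((N'·D(Δ₀) - N(Δ₀)·D')/D(Δ₀)²)`. Bratteli–Robinson II §5.4.1. [folklore] -/
theorem hasDerivAt_thermalCondensate (M : ℕ) [NeZero M] (hE : Even M) (h2 : 2 ≤ M) (β Δ₀ : ℝ) :
    HasDerivAt (fun Δ : ℝ => thermalCondensate M β Δ)
      (((-(β : ℂ) * ∫ s in (0:ℝ)..1,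
          (condensateOp M * sectorProj M *
            gibbsWeight (s * β) (xxzHamiltonian 1 (torusGraph 2 M) (-1) Δ₀) *
            (xxzHamiltonian 1 (torusGraph 2 M) (-1) 1 - xxzHamiltonian 1 (torusGraph 2 M) (-1) 0) *
            gibbsWeight ((1 - s) * β) (xxzHamiltonian 1 (torusGraph 2 M) (-1) Δ₀)).trace) *
          (sectorProj M * gibbsWeight β (xxzHamiltonian 1 (torusGraph 2 M) (-1) Δ₀)).trace -
        (sectorProj M * gibbsWeight β (xxzHamiltonian 1 (torusGraph 2 M) (-1) Δ₀) *
            condensateOp M).trace *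
          (-(β : ℂ) * ∫ s in (0:ℝ)..1,
            (sectorProj M * gibbsWeight (s * β) (xxzHamiltonian 1 (torusGraph 2 M) (-1) Δ₀) *
              (xxzHamiltonian 1 (torusGraph 2 M) (-1) 1 - xxzHamiltonian 1 (torusGraph 2 M) (-1) 0) *
              gibbsWeight ((1 - s) * β) (xxzHamiltonian 1 (torusGraph 2 M) (-1) Δ₀)).trace)) /
        (sectorProj M * gibbsWeight β (xxzHamiltonian 1 (torusGraph 2 M) (-1) Δ₀)).trace ^ 2).re
      Δ₀ := by
  have hN := hasDerivAt_sectorTrace_gibbsWeight_mul M β Δ₀ (condensateOp M)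
  have hD := hasDerivAt_sectorPartition M β Δ₀
  have hD0 : (sectorProj M * gibbsWeight β (xxzHamiltonian 1 (torusGraph 2 M) (-1) Δ₀)).trace ≠ 0 :=
    (sectorPartition_pos M hE h2 β Δ₀).ne'
  have hq := hN.div hD hD0
  have hre := (Complex.reCLM.hasFDerivAt.comp_hasDerivAt Δ₀ hq)
  have hfun : (fun Δ : ℝ => thermalCondensate M β Δ) =
      (Complex.reCLM : ℂ → ℝ) ∘ fun Δ : ℝ =>
        (sectorProj M * gibbsWeight β (xxzHamiltonian 1 (torusGraph 2 M) (-1) Δ) *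
            condensateOp M).trace /
          (sectorProj M * gibbsWeight β (xxzHamiltonian 1 (torusGraph 2 M) (-1) Δ)).trace := by
    funext Δ
    rw [thermalCondensate_eq, Function.comp_apply, Complex.reCLM_apply]
  rw [hfun]
  exact hre

/-- The canonical sector condensate is differentiable in `Δ` (even `M ≥ 2`). [folklore] -/
theorem differentiableAt_thermalCondensate (M : ℕ) [NeZero M] (hE : Even M) (h2 : 2 ≤ M)
    (β Δ₀ : ℝ) : DifferentiableAt ℝ (fun Δ : ℝ => thermalCondensate M β Δ) Δ₀ :=
  (hasDerivAt_thermalCondensate M hE h2 β Δ₀).differentiableAt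

/-- The canonical sector condensate is a continuous function of `Δ` (even `M ≥ 2`). [folklore] -/
theorem continuous_thermalCondensate (M : ℕ) [NeZero M] (hE : Even M) (h2 : 2 ≤ M) (β : ℝ) :
    Continuous fun Δ : ℝ => thermalCondensate M β Δ :=
  continuous_iff_continuousAt.mpr fun Δ₀ =>
    (differentiableAt_thermalCondensate M hE h2 β Δ₀).continuousAt

end Summit.HubbardSuperconductivity.HubbardSuperconductivity.Theorems.AnisotropyChord

end
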